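import Summits.ValiantsHypothesis.ValiantsHypothesis.Theorems.LacunarySymmetroidMatrixDescartesPivotRankOneCriticalWindowsTurningEnds
import Summits.ValiantsHypothesis.ValiantsHypothesis.Theorems.LacunarySymmetroidMatrixDescartesPivotRankOneCriticalWindowsRootCountLone

/-!
# `MatrixDescartes` census — rank-one `(2,4)₁`: THE TURNING-POINT COUNT WITH PARITY ON THE `1|3` SPLIT
# (`#turning points of E` even ⇒ `Z₊(det F) ≤ #turning points + 1`; with the located six turning points this is SEVEN, not eight)

HONEST FRAMING.  Object-search cell `pub-symmetroid`, seat `val-sym-mdr-p1` (generation 27); helper file `--supports` the crux item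
stmt-ValiantsHypothesis-18050 (`Theses.LacunarySymmetroid.MatrixDescartes`, OPEN, on HOLD) with NO closure claim.  `…CriticalWindowsTurning`
(generation 26) proved `Z₊(det F) ≤ #T + 2` for every rank-one hyperbolic row, `T ⊇` the positive zeros of the derivative of the e-free
exponent profile `E`; `…CriticalWindowsTurningEnds` proved `e < E(x)` near `0⁺` and near `∞` on the `1|3` split.  THIS FILE puts the two
together: §1 a generic ROLLE COUNT WITH PARITY (`card_levelSet_le_card_of_gt_ends`: a function differentiable on `(0,∞)` lying strictly ABOVE
a level near both ends has a full positive level set of at most `#T` points whenever `#T` is EVEN — equality `#T + 1` in the plain count would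
make the Rolle points exhaust `T`, so no zero is critical, so the gap signs alternate (IVT + Fermat), impossible between two `+` ends);
§2 ★ `rankOne_oneThree_card_posRoots_le_turning_add_one`: on the `1|3` split of the rank-one `(2,4)₁` cell (`d₀ < e < d₁ ≤ d₂ < d₃`, all-core,
letters `0∦1`, `2∦3`), `T ⊇` positive zeros of `E′` with `#T` EVEN ⇒ `Z₊(det F) ≤ #T + 1`; budget form `…_le_add_one_of_even`; census
currency `rankOne_oneThree_pivotPosRoots_le_turning_add_one` (`pivotPosRoots e d [[0,1],[1,0]] (wₖ(1,tₖ)(1,tₖ)ᵀ) ≤ #T + 1`).  READING: the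
located turning number of `E` at `K = 4` is `6` (seat memo PARITY-AND-PROFILE §1, NOT claimed); under that hypothesis the `1|3` row is
`≤ 7` = SEVEN, the conjectured chamber-(C) value, rather than the parity-free `8`.  Nothing here bears on `MatrixDescartes` in its window,
on `DoorA26` / `DoorA34`, registers / credences, or `VP ≠ VNP`.

[folklore] Rolle (`exists_hasDerivAt_eq_zero`), the intermediate value theorem (`intermediate_value_Icc`), Fermat
(`IsLocalMin.hasDerivAt_eq_zero`), `Finset.orderEmbOfFin`; tree `…Turning.*`, `…TurningEnds.*`, `…RootCount.*`,
`…Resolvent.card_posRoots_le_card_add_one`.  No definitions, no named facts.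
-/

-- `Summit.ValiantsHypothesis.ValiantsHypothesis.…` repeats a component (D-0017 layout); the `dupNamespace` linter flags it; the name is mandated.
set_option linter.dupNamespace false

namespace Summit.ValiantsHypothesis.ValiantsHypothesis.Theorems.LacunarySymmetroidMatrixDescartes.Pivot.CriticalWindows.TurningParity

open Finset Set
open scoped BigOperators Topology
open Summit.ValiantsHypothesis.ValiantsHypothesis.Theorems.LacunarySymmetroidMatrixDescartes.Pivot.CriticalWindows.Turning
  (card_levelSet_le_card_add_one optDir_pos_sq dent_pos differentiableAt_profile critical_iff_profile_eq)
open Summit.ValiantsHypothesis.ValiantsHypothesis.Theorems.LacunarySymmetroidMatrixDescartes.Pivot.CriticalWindows.TurningEnds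
  (profile_gt_near_zero profile_gt_near_infty profile_num_sub)
open Summit.ValiantsHypothesis.ValiantsHypothesis.Theorems.LacunarySymmetroidMatrixDescartes.Pivot.Resolvent
  (card_posRoots_le_card_add_one)
open Summit.ValiantsHypothesis.ValiantsHypothesis.Theorems.LacunarySymmetroidMatrixDescartes.Pivot.CriticalWindows.RootCount
  (moments_pos gapProfile_eq_zero_iff hasDerivAt_gapProfile det_rankOne_hyperbolic_eval)
open Summit.ValiantsHypothesis.ValiantsHypothesis.Theorems.LacunarySymmetroidMatrixDescartes.Pivot (pivotPosRoots)

/-! ## 1. A Rolle count with parity -/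
/-- Same side of a level at the two ends of an interval carrying no level point (intermediate value theorem). [folklore] -/
theorem same_side {ψ : ℝ → ℝ} {c u v : ℝ} (huv : u ≤ v) (hcont : ContinuousOn ψ (Icc u v))
    (hne : ∀ z ∈ Icc u v, ψ z ≠ c) : (c < ψ u ↔ c < ψ v) := by
  constructor
  · intro hu
    by_contra hv
    have hv' : ψ v < c := lt_of_le_of_ne (not_lt.1 hv) (hne v (right_mem_Icc.2 huv))
    obtain ⟨z, hz, hzc⟩ := intermediate_value_Icc' huv hcont ⟨hv'.le, hu.le⟩
    exact hne z hz hzc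
  · intro hv
    by_contra hu
    have hu' : ψ u < c := lt_of_le_of_ne (not_lt.1 hu) (hne u (left_mem_Icc.2 huv))
    obtain ⟨z, hz, hzc⟩ := intermediate_value_Icc huv hcont ⟨hu'.le, hv.le⟩
    exact hne z hz hzc

/-- Fermat: a point where the function is locally minimal has zero derivative. [folklore] -/
theorem deriv_eq_zero_of_le_near {ψ : ℝ → ℝ} {D l u ρ : ℝ} (hl : l < ρ) (hu : ρ < u)
    (hge : ∀ x ∈ Ioo l u, ψ ρ ≤ ψ x) (hd : HasDerivAt ψ D ρ) : D = 0 :=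
  IsLocalMin.hasDerivAt_eq_zero (Filter.eventually_of_mem (Ioo_mem_nhds hl hu) hge) hd

/-- Fermat: a point where the function is locally maximal has zero derivative. [folklore] -/
theorem deriv_eq_zero_of_ge_near {ψ : ℝ → ℝ} {D l u ρ : ℝ} (hl : l < ρ) (hu : ρ < u)
    (hle : ∀ x ∈ Ioo l u, ψ x ≤ ψ ρ) (hd : HasDerivAt ψ D ρ) : D = 0 :=
  IsLocalMax.hasDerivAt_eq_zero (Filter.eventually_of_mem (Ioo_mem_nhds hl hu) hle) hd

/-- **ROLLE COUNT WITH PARITY.**  `ψ` has derivative `ψ′` on `(0,∞)`; `S` is the FULL finite set of positive points where `ψ = c`;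
`T` contains every positive zero of `ψ′`; `ψ > c` near `0⁺` and near `∞`.  If `#T` is even then `#S ≤ #T` (the plain Rolle count gives
`#S ≤ #T + 1`; equality would force the `#T = #S − 1` critical points to interlace the zeros, hence no zero is critical, hence the
signs of `ψ − c` on the `#S + 1` gaps alternate — impossible between two `+` ends when `#S` is odd). [folklore] -/
theorem card_levelSet_le_card_of_gt_ends (ψ ψ' : ℝ → ℝ) (c : ℝ) (hder : ∀ x, 0 < x → HasDerivAt ψ (ψ' x) x)
    (S : Finset ℝ) (hS : ∀ x ∈ S, 0 < x ∧ ψ x = c) (hfull : ∀ x, 0 < x → ψ x = c → x ∈ S)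
    (T : Finset ℝ) (hT : ∀ y, 0 < y → ψ' y = 0 → y ∈ T) (hTeven : Even T.card)
    (h0 : ∃ a, 0 < a ∧ ∀ x, 0 < x → x ≤ a → c < ψ x) (h1 : ∃ b, 0 < b ∧ ∀ x, b ≤ x → c < ψ x) :
    S.card ≤ T.card := by
  classical
  have hle := card_levelSet_le_card_add_one ψ ψ' c hder S hS T hT
  by_contra hgt
  push Not at hgt
  obtain ⟨n, hn⟩ : ∃ n, S.card = n := ⟨_, rfl⟩
  have hnT : n = T.card + 1 := by omega
  have hnodd : Odd n := by rw [hnT]; exact hTeven.add_one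
  set r := S.orderEmbOfFin hn with hr
  set rr : ℕ → ℝ := fun i => if h : i < n then r ⟨i, h⟩ else 0 with hrrdef
  have hrr : ∀ i (h : i < n), rr i = r ⟨i, h⟩ := fun i h => by simp [hrrdef, h]
  have hrS : ∀ i, i < n → rr i ∈ S := fun i h => by rw [hrr i h]; exact Finset.orderEmbOfFin_mem _ _ _
  have hrpos : ∀ i, i < n → 0 < rr i := fun i h => (hS _ (hrS i h)).1
  have hrval : ∀ i, i < n → ψ (rr i) = c := fun i h => (hS _ (hrS i h)).2
  have hmono : ∀ i j, i < j → j < n → rr i < rr j := fun i j hij hj => by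
    rw [hrr i (by omega), hrr j hj]; exact r.strictMono (Fin.mk_lt_mk.2 hij)
  have hmono' : ∀ i j, i ≤ j → j < n → rr i ≤ rr j := fun i j hij hj =>
    (eq_or_lt_of_le hij).elim (fun h => h ▸ le_rfl) (fun h => (hmono i j h hj).le)
  have hsurj : ∀ x ∈ S, ∃ i, i < n ∧ rr i = x := fun x hx => by
    obtain ⟨⟨i, hi⟩, hix⟩ := (show x ∈ Set.range r by rw [Finset.range_orderEmbOfFin]; exact hx)
    exact ⟨i, hi, by rw [hrr i hi]; exact hix⟩
  have hsqueeze : ∀ i j, j < n → i + 1 < n → rr i < rr j → rr j < rr (i + 1) → False := by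
    intro i j hj hi h1 h2
    have hij : i < j := lt_of_not_ge fun h => absurd h1 (not_lt.2 (hmono' j i h (by omega)))
    have hji : j < i + 1 := lt_of_not_ge fun h => absurd h2 (not_lt.2 (hmono' (i + 1) j h hj))
    omega
  -- Rolle points between consecutive zeros; they exhaust `T`
  have hcontI : ∀ u v, 0 < u → ContinuousOn ψ (Icc u v) :=
    fun u v hu x hx => (hder x (lt_of_lt_of_le hu hx.1)).continuousAt.continuousWithinAt
  have hex : ∀ i, i + 1 < n → ∃ y, rr i < y ∧ y < rr (i + 1) ∧ ψ' y = 0 := by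
    intro i hi
    have ha := hrpos i (by omega)
    obtain ⟨y, hy, hy0⟩ := exists_hasDerivAt_eq_zero (hmono i (i + 1) (by omega) hi) (hcontI _ _ ha)
      (by rw [hrval i (by omega), hrval (i + 1) hi]) fun x hx => hder x (ha.trans hx.1)
    exact ⟨y, hy.1, hy.2, hy0⟩
  choose! y hy using hex
  have hyT : ∀ i, i + 1 < n → y i ∈ T := fun i hi => hT _ ((hrpos i (by omega)).trans (hy i hi).1) (hy i hi).2.2
  have hymono : ∀ i j, i < j → j + 1 < n → y i < y j := fun i j hij hj =>
    calc y i < rr (i + 1) := (hy i (by omega)).2.1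
      _ ≤ rr j := hmono' (i + 1) j (by omega) (by omega)
      _ < y j := (hy j hj).1
  have hYsub : (Finset.range (n - 1)).image y ⊆ T := fun z hz => by
    obtain ⟨i, hi, rfl⟩ := Finset.mem_image.1 hz
    exact hyT i (by simp only [Finset.mem_range] at hi; omega)
  have hYcard : ((Finset.range (n - 1)).image y).card = n - 1 := by
    rw [Finset.card_image_of_injOn, Finset.card_range]
    intro i hi j hj hij
    simp only [Finset.coe_range, Set.mem_Iio] at hi hj
    by_contra hne
    rcases lt_or_gt_of_ne hne with h | h
    · exact absurd hij (hymono i j h (by omega)).ne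
    · exact absurd hij (hymono j i h (by omega)).ne'
  have hYT : (Finset.range (n - 1)).image y = T :=
    Finset.eq_of_subset_of_card_le hYsub (by rw [hYcard]; omega)
  -- consequently no zero is a critical point
  have hr_notcrit : ∀ j, j < n → ψ' (rr j) ≠ 0 := by
    intro j hj h0
    have hmem : rr j ∈ T := hT _ (hrpos j hj) h0
    rw [← hYT] at hmem
    obtain ⟨i, hi, hiy⟩ := Finset.mem_image.1 hmem
    simp only [Finset.mem_range] at hi
    exact hsqueeze i j hj (by omega) (by rw [← hiy]; exact (hy i (by omega)).1) (by rw [← hiy]; exact (hy i (by omega)).2.1)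
  have hoff : ∀ x, 0 < x → ψ x = c → ∃ i, i < n ∧ rr i = x := fun x hx hxc => hsurj x (hfull x hx hxc)
  have hgap_ne : ∀ i, i + 1 < n → ∀ z, rr i < z → z < rr (i + 1) → ψ z ≠ c := by
    intro i hi z hz1 hz2 hzc
    obtain ⟨j, hj, hjz⟩ := hoff z ((hrpos i (by omega)).trans hz1) hzc
    exact hsqueeze i j hj hi (by rw [hjz]; exact hz1) (by rw [hjz]; exact hz2)
  have hlow_ne : ∀ z, 0 < z → z < rr 0 → ψ z ≠ c := by
    intro z hz hz0 hzc
    obtain ⟨j, hj, hjz⟩ := hoff z hz hzc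
    rw [← hjz] at hz0
    exact absurd hz0 (not_lt.2 (hmono' 0 j (Nat.zero_le _) hj))
  have hhigh_ne : ∀ z, rr (n - 1) < z → ψ z ≠ c := by
    intro z hz hzc
    obtain ⟨j, hj, hjz⟩ := hoff z ((hrpos (n - 1) (by omega)).trans hz) hzc
    rw [← hjz] at hz
    exact absurd hz (not_lt.2 (hmono' j (n - 1) (by omega) (by omega)))
  -- below the first zero and above the last zero: above the level
  obtain ⟨a, ha, h0a⟩ := h0
  obtain ⟨b, hb, h1b⟩ := h1
  have hlow_pos : ∀ z, 0 < z → z < rr 0 → c < ψ z := by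
    intro z hz hz0
    have hu0 : 0 < min z a := lt_min hz ha
    have hcu : c < ψ (min z a) := h0a _ hu0 (min_le_right _ _)
    exact (same_side (min_le_left z a) (hcontI _ z hu0)
      (fun w hw => hlow_ne w (lt_of_lt_of_le hu0 hw.1) (lt_of_le_of_lt hw.2 hz0))).1 hcu
  have hhigh_pos : ∀ z, rr (n - 1) < z → c < ψ z := by
    intro z hz
    have hcv : c < ψ (max z b) := h1b _ (le_max_right _ _)
    exact (same_side (le_max_left z b) (hcontI z _ ((hrpos (n - 1) (by omega)).trans hz))
      (fun w hw => hhigh_ne w (lt_of_lt_of_le hz hw.1))).2 hcv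
  -- signs on the gaps are constant: `Pos i` := above the level at the midpoint of gap `i`
  have hgap_const : ∀ i, i + 1 < n → ∀ z z', rr i < z → z < rr (i + 1) → rr i < z' → z' < rr (i + 1) →
      (c < ψ z ↔ c < ψ z') := by
    intro i hi z z' hz1 hz2 hz1' hz2'
    rcases le_total z z' with h | h
    · exact same_side h (hcontI z z' ((hrpos i (by omega)).trans hz1))
        (fun w hw => hgap_ne i hi w (lt_of_lt_of_le hz1 hw.1) (lt_of_le_of_lt hw.2 hz2'))
    · exact (same_side h (hcontI z' z ((hrpos i (by omega)).trans hz1'))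
        (fun w hw => hgap_ne i hi w (lt_of_lt_of_le hz1' hw.1) (lt_of_le_of_lt hw.2 hz2))).symm
  set Pos : ℕ → Prop := fun i => c < ψ ((rr i + rr (i + 1)) / 2) with hPos
  have hmid : ∀ i, i + 1 < n → rr i < (rr i + rr (i + 1)) / 2 ∧ (rr i + rr (i + 1)) / 2 < rr (i + 1) := by
    intro i hi; have := hmono i (i + 1) (by omega) hi; constructor <;> linarith
  have hgap_ge : ∀ i, i + 1 < n → Pos i → ∀ z, rr i < z → z < rr (i + 1) → c ≤ ψ z := fun i hi hp z hz1 hz2 =>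
    ((hgap_const i hi z _ hz1 hz2 (hmid i hi).1 (hmid i hi).2).2 hp).le
  have hgap_le : ∀ i, i + 1 < n → ¬ Pos i → ∀ z, rr i < z → z < rr (i + 1) → ψ z ≤ c := fun i hi hp z hz1 hz2 =>
    not_lt.1 fun h => hp ((hgap_const i hi z _ hz1 hz2 (hmid i hi).1 (hmid i hi).2).1 h)
  -- a zero flanked by `≥ c` on both sides (or `≤ c` on both sides) would be critical: contradiction
  have hnotmin : ∀ j, j < n → ∀ l u, l < rr j → rr j < u →
      (∀ z, l < z → z < rr j → c ≤ ψ z) → (∀ z, rr j < z → z < u → c ≤ ψ z) → False := by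
    intro j hj l u hl hu hL hR
    refine hr_notcrit j hj (deriv_eq_zero_of_le_near hl hu (fun z hz => ?_) (hder _ (hrpos j hj)))
    rcases lt_trichotomy z (rr j) with h | h | h
    · exact (hrval j hj).le.trans (hL z hz.1 h)
    · exact h ▸ le_rfl
    · exact (hrval j hj).le.trans (hR z h hz.2)
  have hnotmax : ∀ j, j < n → ∀ l u, l < rr j → rr j < u →
      (∀ z, l < z → z < rr j → ψ z ≤ c) → (∀ z, rr j < z → z < u → ψ z ≤ c) → False := by
    intro j hj l u hl hu hL hR
    refine hr_notcrit j hj (deriv_eq_zero_of_ge_near hl hu (fun z hz => ?_) (hder _ (hrpos j hj)))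
    rcases lt_trichotomy z (rr j) with h | h | h
    · exact (hL z hz.1 h).trans (hrval j hj).ge
    · exact h ▸ le_rfl
    · exact (hR z h hz.2).trans (hrval j hj).ge
  -- case `n = 1`: both ends above the level ⇒ `rr 0` is a local minimum
  rcases Nat.lt_or_ge n 2 with hn2 | hn2
  · have h00 : 0 < n := by omega
    exact hnotmin 0 h00 (rr 0 / 2) (rr 0 + 1) (by linarith [hrpos 0 h00]) (by linarith)
      (fun z hz1 hz2 => (hlow_pos z (by linarith [hrpos 0 h00]) hz2).le)
      (fun z hz1 _ => (hhigh_pos z (by rw [show n - 1 = 0 by omega]; exact hz1)).le)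
  -- case `n ≥ 2` (hence `n ≥ 3`, `n` being odd): the gap signs alternate from `−` and end at `−`
  have hP0 : ¬ Pos 0 := fun hp =>
    hnotmin 0 (by omega) (rr 0 / 2) (rr 1) (by linarith [hrpos 0 (by omega)]) (hmono 0 1 (by omega) hn2)
      (fun z hz1 hz2 => (hlow_pos z (by linarith [hrpos 0 (by omega)]) hz2).le)
      (fun z hz1 hz2 => hgap_ge 0 (by omega) hp z hz1 hz2)
  have hPlast : ¬ Pos (n - 2) := fun hp =>
    hnotmin (n - 1) (by omega) (rr (n - 2)) (rr (n - 1) + 1) (hmono (n - 2) (n - 1) (by omega) (by omega)) (by linarith)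
      (fun z hz1 hz2 => hgap_ge (n - 2) (by omega) hp z hz1 (by rwa [show n - 2 + 1 = n - 1 by omega]))
      (fun z hz1 _ => (hhigh_pos z hz1).le)
  have halt : ∀ i, i + 2 < n → (Pos i ↔ ¬ Pos (i + 1)) := by
    intro i hi
    constructor
    · intro hp hp'
      exact hnotmin (i + 1) (by omega) (rr i) (rr (i + 2)) (hmono i (i + 1) (by omega) (by omega))
        (hmono (i + 1) (i + 2) (by omega) hi)
        (fun z hz1 hz2 => hgap_ge i (by omega) hp z hz1 hz2) (fun z hz1 hz2 => hgap_ge (i + 1) hi hp' z hz1 hz2)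
    · intro hp'
      by_contra hp
      exact hnotmax (i + 1) (by omega) (rr i) (rr (i + 2)) (hmono i (i + 1) (by omega) (by omega))
        (hmono (i + 1) (i + 2) (by omega) hi)
        (fun z hz1 hz2 => hgap_le i (by omega) hp z hz1 hz2) (fun z hz1 hz2 => hgap_le (i + 1) hi hp' z hz1 hz2)
  have hind : ∀ i, i + 1 < n → (Pos i ↔ Odd i) := by
    intro i
    induction i with
    | zero =>
        intro _
        exact ⟨fun hp => absurd hp hP0, fun ho => absurd ho (by decide)⟩
    | succ k ih =>
        intro hk
        have h1 := halt k (by omega)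
        have h2 := ih (by omega)
        rw [Nat.odd_add_one]
        constructor
        · intro hp hok
          exact (h1.1 (h2.2 hok)) hp
        · intro hnok
          by_contra hp
          exact hnok (h2.1 (h1.2 hp))
  have hodd2 : Odd (n - 2) := by
    obtain ⟨k, hk⟩ := hnodd
    exact ⟨k - 1, by omega⟩
  exact hPlast ((hind (n - 2) (by omega)).2 hodd2)

/-! ## 2. The `1|3` row: turning points with parity -/
/-- **★ THE TURNING-POINT COUNT WITH PARITY ON THE `1|3` SPLIT.**  Rank-one hyperbolic pencil data on four letters: positive weights `wₖ`,
positive positions `tₖ` with letters `0, 1` and `2, 3` non-parallel, exponents `d₀ < e < d₁ ≤ d₂ < d₃` (ONE letter below the pivot); `f`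
any real polynomial whose positive roots are the positive zeros of `A C − (U + x^e)²` (`= det F`).  If the finite set `T` contains every
positive zero of the derivative of the e-free exponent profile `E` and `#T` is EVEN, then **`Z₊(f) ≤ #T + 1`** (one better than the
parity-free `#T + 2` of `…Turning.rankOne_card_posRoots_le_turning_add_two`). [this file] -/
theorem rankOne_oneThree_card_posRoots_le_turning_add_one (w t : Fin 4 → ℝ) (d : Fin 4 → ℕ) (e : ℕ)
    (hw : ∀ k, 0 < w k) (ht : ∀ k, 0 < t k) (h01 : t 0 ≠ t 1) (h23 : t 2 ≠ t 3)
    (h0e : d 0 < e) (he1 : e < d 1) (h12 : d 1 ≤ d 2) (hd23 : d 2 < d 3) (f : Polynomial ℝ)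
    (hf : ∀ x, 0 < x → (f.IsRoot x ↔ (∑ k, w k * x ^ d k) * (∑ k, w k * t k ^ 2 * x ^ d k)
      - ((∑ k, w k * t k * x ^ d k) + x ^ e) ^ 2 = 0))
    (T : Finset ℝ) (hT : ∀ y, 0 < y → deriv (fun z =>
      (∑ k, (d k : ℝ) * (w k * z ^ d k)
          * (Real.sqrt ((∑ l, w l * t l ^ 2 * z ^ d l) / (∑ l, w l * z ^ d l)) - t k) ^ 2)
        / (∑ k, w k * z ^ d k
          * (Real.sqrt ((∑ l, w l * t l ^ 2 * z ^ d l) / (∑ l, w l * z ^ d l)) - t k) ^ 2)) y = 0 → y ∈ T)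
    (hTeven : Even T.card) :
    (f.roots.toFinset.filter (fun r => 0 < r)).card ≤ T.card + 1 := by
  classical
  have hs : (Finset.univ : Finset (Fin 4)).Nonempty := ⟨0, Finset.mem_univ _⟩
  have hw' : ∀ m ∈ (Finset.univ : Finset (Fin 4)), 0 < w m := fun m _ => hw m
  have ht' : ∀ m ∈ (Finset.univ : Finset (Fin 4)), 0 < t m := fun m _ => ht m
  have hi : (0 : Fin 4) ∈ (Finset.univ : Finset (Fin 4)) := Finset.mem_univ _
  have hj : (1 : Fin 4) ∈ (Finset.univ : Finset (Fin 4)) := Finset.mem_univ _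
  -- the optimal direction and the gap profile of row `e` (as in `…Turning`)
  set τ : ℝ → ℝ := fun x => Real.sqrt ((∑ k, w k * t k ^ 2 * x ^ d k) / (∑ k, w k * x ^ d k)) with hτdef
  have hτ : ∀ x, 0 < x → 0 < τ x ∧ (∑ k, w k * x ^ d k) * τ x ^ 2 = ∑ k, w k * t k ^ 2 * x ^ d k :=
    fun x hx => optDir_pos_sq Finset.univ hs w t d hw' ht' hx
  set φ : ℝ → ℝ := fun y => (Real.sqrt ((∑ k, w k * y ^ d k) * (∑ k, w k * t k ^ 2 * y ^ d k))
      - ∑ k, w k * t k * y ^ d k) / y ^ e - 1 with hφdef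
  set φ' : ℝ → ℝ := fun x => (∑ k, ((d k : ℝ) - e) * (w k * x ^ d k) * (τ x - t k) ^ 2) / (2 * τ x * x ^ (e + 1))
    with hφ'def
  have hφ : ∀ x, 0 < x → (φ x = 0 ↔ f.IsRoot x) := by
    intro x hx
    obtain ⟨hA, hU, hC⟩ := moments_pos Finset.univ hs w t d hw' ht' hx
    rw [hf x hx, hφdef]
    exact gapProfile_eq_zero_iff _ _ _ _ (mul_pos hA hC).le (add_pos hU (pow_pos hx e)).le (pow_pos hx e)
  have hder : ∀ x, 0 < x → HasDerivAt φ (φ' x) x := fun x hx =>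
    hasDerivAt_gapProfile Finset.univ hs w t d e hw' ht' hx (hτ x hx).1 (hτ x hx).2
  -- the e-free exponent profile and its derivative
  set E : ℝ → ℝ := fun z =>
      (∑ k, (d k : ℝ) * (w k * z ^ d k)
          * (Real.sqrt ((∑ l, w l * t l ^ 2 * z ^ d l) / (∑ l, w l * z ^ d l)) - t k) ^ 2)
        / (∑ k, w k * z ^ d k
          * (Real.sqrt ((∑ l, w l * t l ^ 2 * z ^ d l) / (∑ l, w l * z ^ d l)) - t k) ^ 2) with hEdef
  have hEder : ∀ x, 0 < x → HasDerivAt E (deriv E x) x := fun x hx =>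
    (differentiableAt_profile Finset.univ w t d hw' ht' hi hj h01 hx).hasDerivAt
  -- a critical point of the gap profile is a level point of `E`
  have hcritE : ∀ c, 0 < c → φ' c = 0 → E c = e := by
    intro c hc h0
    have hE1 : ∑ m, w m * c ^ d m * (τ c ^ 2 - t m ^ 2) = 0 := by
      have : ∑ m, w m * c ^ d m * (τ c ^ 2 - t m ^ 2)
          = (∑ k, w k * c ^ d k) * τ c ^ 2 - ∑ k, w k * t k ^ 2 * c ^ d k := by
        rw [Finset.sum_mul, ← Finset.sum_sub_distrib]
        exact Finset.sum_congr rfl fun k _ => by ring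
      rw [this, (hτ c hc).2, sub_self]
    have hE2 : ∑ m, ((d m : ℝ) - e) * (w m * c ^ d m) * (τ c - t m) ^ 2 = 0 := by
      rw [hφ'def, div_eq_zero_iff] at h0
      rcases h0 with h0 | h0
      · exact h0
      · exact absurd h0 (mul_pos (mul_pos two_pos (hτ c hc).1) (pow_pos hc _)).ne'
    exact (critical_iff_profile_eq Finset.univ w t d e hw' ht' hi hj h01 hc).1 ⟨τ c, (hτ c hc).1, hE1, hE2⟩
  -- the full positive level set of `E` at `e` is finite with at most `#T` elements (the Rolle count with parity)
  set L : Set ℝ := {x | 0 < x ∧ E x = e} with hL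
  have hbudget : ∀ S : Finset ℝ, (∀ x ∈ S, 0 < x ∧ E x = e) → S.card ≤ T.card + 1 :=
    fun S hS => card_levelSet_le_card_add_one E (deriv E) (e : ℝ) hEder S hS T hT
  have hLfin : L.Finite := by
    by_contra hinf
    obtain ⟨S, hS, hcard⟩ := Set.Infinite.exists_subset_card_eq hinf (T.card + 2)
    have := hbudget S fun x hx => hS hx
    omega
  have hLcard : hLfin.toFinset.card ≤ T.card :=
    card_levelSet_le_card_of_gt_ends E (deriv E) e hEder hLfin.toFinset (fun x hx => by simpa [hL] using hx)
      (fun x hx hxe => by simp only [Set.Finite.mem_toFinset, hL, Set.mem_setOf_eq]; exact ⟨hx, hxe⟩) T hT hTeven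
      (profile_gt_near_zero w t d e hw ht h01 h0e he1 h12 (h12.trans hd23.le))
      (profile_gt_near_infty w t d e hw ht h01 h23 h0e he1.le h12 (lt_of_lt_of_le he1 h12) hd23)
  -- the positive critical points of the gap profile lie in that level set
  set crit : Set ℝ := {c | 0 < c ∧ φ' c = 0} with hcrit
  have hcritsub : crit ⊆ L := fun c hc => ⟨hc.1, hcritE c hc.1 hc.2⟩
  have hcritfin : crit.Finite := hLfin.subset hcritsub
  have hcard_crit : hcritfin.toFinset.card ≤ T.card := by
    refine le_trans (Finset.card_le_card fun c hc => ?_) hLcard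
    rw [Set.Finite.mem_toFinset] at hc ⊢
    exact hcritsub hc
  have h := card_posRoots_le_card_add_one f φ φ' hφ hder hcritfin.toFinset
    (fun c hc h0 => by simpa [hcrit] using And.intro hc h0)
  omega

/-- **BUDGET FORM.**  Same data; if every finite set of positive zeros of the derivative of the e-free exponent profile has at most `N`
elements and `N` is even, then `Z₊(f) ≤ N + 1` on the `1|3` split.  (With the located `N = 6`: SEVEN.) [this file] -/
theorem rankOne_oneThree_card_posRoots_le_add_one_of_even (w t : Fin 4 → ℝ) (d : Fin 4 → ℕ) (e : ℕ)
    (hw : ∀ k, 0 < w k) (ht : ∀ k, 0 < t k) (h01 : t 0 ≠ t 1) (h23 : t 2 ≠ t 3)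
    (h0e : d 0 < e) (he1 : e < d 1) (h12 : d 1 ≤ d 2) (hd23 : d 2 < d 3) (f : Polynomial ℝ)
    (hf : ∀ x, 0 < x → (f.IsRoot x ↔ (∑ k, w k * x ^ d k) * (∑ k, w k * t k ^ 2 * x ^ d k)
      - ((∑ k, w k * t k * x ^ d k) + x ^ e) ^ 2 = 0))
    (N : ℕ) (hNeven : Even N) (hN : ∀ T : Finset ℝ, (∀ y ∈ T, 0 < y ∧ deriv (fun z =>
      (∑ k, (d k : ℝ) * (w k * z ^ d k)
          * (Real.sqrt ((∑ l, w l * t l ^ 2 * z ^ d l) / (∑ l, w l * z ^ d l)) - t k) ^ 2)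
        / (∑ k, w k * z ^ d k
          * (Real.sqrt ((∑ l, w l * t l ^ 2 * z ^ d l) / (∑ l, w l * z ^ d l)) - t k) ^ 2)) y = 0) → T.card ≤ N) :
    (f.roots.toFinset.filter (fun r => 0 < r)).card ≤ N + 1 := by
  classical
  set E : ℝ → ℝ := fun z =>
      (∑ k, (d k : ℝ) * (w k * z ^ d k)
          * (Real.sqrt ((∑ l, w l * t l ^ 2 * z ^ d l) / (∑ l, w l * z ^ d l)) - t k) ^ 2)
        / (∑ k, w k * z ^ d k
          * (Real.sqrt ((∑ l, w l * t l ^ 2 * z ^ d l) / (∑ l, w l * z ^ d l)) - t k) ^ 2) with hEdef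
  set Z : Set ℝ := {y | 0 < y ∧ deriv E y = 0} with hZ
  have hfin : Z.Finite := by
    by_contra hinf
    obtain ⟨T, hTZ, hcard⟩ := Set.Infinite.exists_subset_card_eq hinf (N + 1)
    have := hN T fun y hy => hTZ hy
    omega
  have hcardT : hfin.toFinset.card ≤ N := hN _ fun y hy => by simpa [hZ] using hy
  -- pad the zero set of `E′` to an EVEN-sized finite set with the negative real `−1` (never a positive zero)
  obtain ⟨P, hPT, hPcard, hPeven⟩ : ∃ P : Finset ℝ, hfin.toFinset ⊆ P ∧ P.card ≤ N ∧ Even P.card := by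
    rcases Nat.even_or_odd hfin.toFinset.card with hev | hod
    · exact ⟨hfin.toFinset, le_refl _, hcardT, hev⟩
    · have hlt : hfin.toFinset.card < N :=
        lt_of_le_of_ne hcardT fun h => (Nat.not_even_iff_odd.2 hod) (h ▸ hNeven)
      have hnotin : (-1 : ℝ) ∉ hfin.toFinset := fun hm => by
        have hm' : (-1 : ℝ) ∈ Z := by simpa using hm
        linarith [hm'.1]
      refine ⟨insert (-1) hfin.toFinset, Finset.subset_insert _ _, ?_, ?_⟩
      · rw [Finset.card_insert_of_notMem hnotin]; omega
      · rw [Finset.card_insert_of_notMem hnotin]; exact hod.add_one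
  have h := rankOne_oneThree_card_posRoots_le_turning_add_one w t d e hw ht h01 h23 h0e he1 h12 hd23 f hf P
    (fun y hy h0 => hPT (by simpa [hZ] using And.intro hy h0)) hPeven
  omega

/-- **CENSUS CURRENCY.**  Same statement for the pivot pencil itself: `pivotPosRoots e d [[0,1],[1,0]] (k ↦ wₖ·(1,tₖ)(1,tₖ)ᵀ) ≤ #T + 1` on the
`1|3` split when `#T` is even (`T ⊇` the positive zeros of `E′`). [this file] -/
theorem rankOne_oneThree_pivotPosRoots_le_turning_add_one (w t : Fin 4 → ℝ) (d : Fin 4 → ℕ) (e : ℕ)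
    (hw : ∀ k, 0 < w k) (ht : ∀ k, 0 < t k) (h01 : t 0 ≠ t 1) (h23 : t 2 ≠ t 3)
    (h0e : d 0 < e) (he1 : e < d 1) (h12 : d 1 ≤ d 2) (hd23 : d 2 < d 3)
    (T : Finset ℝ) (hT : ∀ y, 0 < y → deriv (fun z =>
      (∑ k, (d k : ℝ) * (w k * z ^ d k)
          * (Real.sqrt ((∑ l, w l * t l ^ 2 * z ^ d l) / (∑ l, w l * z ^ d l)) - t k) ^ 2)
        / (∑ k, w k * z ^ d k
          * (Real.sqrt ((∑ l, w l * t l ^ 2 * z ^ d l) / (∑ l, w l * z ^ d l)) - t k) ^ 2)) y = 0 → y ∈ T)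
    (hTeven : Even T.card) :
    pivotPosRoots e d (!![(0 : ℝ), 1; 1, 0]) (fun k => w k • Matrix.vecMulVec ![1, t k] ![1, t k]) ≤ T.card + 1 := by
  unfold pivotPosRoots
  exact rankOne_oneThree_card_posRoots_le_turning_add_one w t d e hw ht h01 h23 h0e he1 h12 hd23 _
    (fun x _ => by rw [Polynomial.IsRoot.def, det_rankOne_hyperbolic_eval]) T hT hTeven

end Summit.ValiantsHypothesis.ValiantsHypothesis.Theorems.LacunarySymmetroidMatrixDescartes.Pivot.CriticalWindows.TurningParity
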